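import Mathlib
import HarnessLib
import Literature.MathematicalPhysics.QuantumLattice.HubbardUVSymbolBandComposition

/-!
# Directional derivatives of the ultraviolet symbol `Ψ(ω,e) = χ(4(ω²+e²)/Λ²)/(iω − e)` on the frequency–band plane and the two
# interpolations (in the BAND and in the FREQUENCY) that turn lattice mixed differences of increments into integrands

Topic `MathematicalPhysics/QuantumLattice`; continues `HubbardUVSymbolJoint` (the symbol `uvSymbol₂ c Λ` on `FreqBand = ℝ²` and its
derivative bounds `‖DⁿΨ(x)‖ ≤ c·B·(n+1)!·(2/max(|ω|,Λ/2))^{n+1}`) and `HubbardUVSymbolBandComposition` (the band line `fbPt ω e`, the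
Faà di Bruno bound for `Ψ(ω,u(p))`, the band derivative `uvSymbol₂E` and the interpolation of an increment of bands).  For the FIRST
SPACE MOMENTS of the scale-`0` covariance of a framed band `e_K = ε − μ − Σₘ Kₘ` (Benfatto–Giuliani–Mastropietro 2006, §2.1 and §3:
the propagator of the band is telescoped over the pieces `Kₘ` of the frame, (3.2)–(3.8)) the mixed lattice differences needed are
(i) those of `Ψ(ω, v + w) − Ψ(ω, v)` (an increment of bands: interpolate `s ↦ Ψ(ω, v + s w)`, integrand `∂_eΨ·w`), (ii) those of
`Ψ(ω′, u) − Ψ(ω, u)` (one time difference: interpolate `t ↦ Ψ(ω + t(ω′−ω), u)`, integrand `∂_ωΨ·(ω′−ω)`), and (iii) both at once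
(integrand `∂_ω∂_eΨ·w·(ω′−ω)`).  This file supplies the pieces GENERICALLY in the smooth function `g` on the plane (so that they
apply to `Ψ`, `∂_eΨ`, `∂_ωΨ`, `∂_ω∂_eΨ` alike):

* `fbDir g v` — the directional derivative `x ↦ Dg(x)(v)`; `uvSymbol₂E = fbDir Ψ e₁`; `contDiff_fbDir`;
  **`norm_iteratedFDeriv_fbDir_le`** `‖Dⁱ(∂_v g)(x)‖ ≤ ‖v‖·‖D^{i+1}g(x)‖`;
* **`norm_iteratedFDeriv_comp_fbPt_le`**, **`norm_iteratedFDeriv_comp_fbPt_mul_le`** — the Faà di Bruno / Leibniz bounds of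
  `HubbardUVSymbolBandComposition` for a general smooth `g` (`‖Dⁿ(g(ω,u ·))‖ ≤ n!·C·Dⁿ`, `‖Dᵇ(g(ω,u ·)·κ)‖ ≤ Σ_j C(b,j)·j!·C′·Dʲ·‖D^{b-j}κ‖`);
* `fwdDiff_iter_mul_const`, `fwdDiff_iter₂_mul_const` — constants pass through iterated differences;
* `hasDerivAt_comp_fbPt_band`, `hasDerivAt_comp_fbPt_freq` — the two interpolating families and their derivatives;
* **`norm_fwdDiff_iter₂_comp_fbPt_band_increment_le`**, **`norm_fwdDiff_iter₂_comp_fbPt_freq_increment_le`** — mixed lattice differences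
  of the two kinds of increments are bounded by those of the integrands;
* **`norm_iteratedFDeriv_fbDir_uvSymbol₂_le`**, **`norm_iteratedFDeriv_fbDir_fbDir_uvSymbol₂_le`** — `‖Dⁱ∂_vΨ‖ ≤ ‖v‖·cB(i+2)!(2/max(|ω|,Λ/2))^{i+2}`,
  `‖Dⁱ∂_{v′}∂_vΨ‖ ≤ ‖v′‖‖v‖·cB(i+3)!(2/max(|ω|,Λ/2))^{i+3}`;
* `abs_fbPt_interp_zero_ge`, **`two_div_max_fbPt_interp_pow_le`** — on the segment from `(ω,e)` to `(ω′,e)` the frequency envelope is at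
  least the SHIFTED envelope `max(|ω| − |ω′−ω|, Λ/2)` (`MatsubaraShiftedEnvelopeSums`); `two_div_max_pow_add_le` — `(2/m)^{i+k} ≤ (4/Λ)ⁱ(2/m)ᵏ`.

Everything is proved; `fbDir` is the only definition; no named facts.

## Sources

G. Benfatto, A. Giuliani, V. Mastropietro, Ann. Henri Poincaré 7 (2006) 809–898, §2.1 (2.36aa), §3 (3.2)–(3.8)
(`BenfattoGiulianiMastropietro2006`); M. Salmhofer, *Renormalization* (1999), §4.2.5 (4.70) (`Salmhofer1999`).
-/

noncomputable section

namespace Literature.MathematicalPhysics.QuantumLattice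

open Literature.Probability.LatticeModels Set Complex Filter
open scoped Nat Topology

/-! ### §1 Directional derivatives on the plane -/

/-- The directional derivative `∂_v g(x) = Dg(x)(v)` of a function on the frequency–band plane.
[cite: BenfattoGiulianiMastropietro2006, (2.36aa)] -/
def fbDir (g : FreqBand → ℂ) (v : FreqBand) (x : FreqBand) : ℂ := fderiv ℝ g x v

/-- The band derivative of `HubbardUVSymbolBandComposition` is `∂_{e₁}Ψ`. [cite: Salmhofer1999, §4.2.5 (4.70)] -/
theorem uvSymbol₂E_eq_fbDir (c Λ : ℝ) : uvSymbol₂E c Λ = fbDir (uvSymbol₂ c Λ) fbE1 := rfl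

/-- `∂_v g` is `Cⁿ` when `g` is `C^{n+1}`. [cite: BenfattoGiulianiMastropietro2006, (2.36aa)] -/
theorem contDiff_fbDir {g : FreqBand → ℂ} {n : ℕ∞} (hg : ContDiff ℝ (n + 1) g) (v : FreqBand) : ContDiff ℝ n (fbDir g v) := by
  have h : ContDiff ℝ n (fderiv ℝ g) := hg.fderiv_right le_rfl
  exact h.clm_apply contDiff_const

/-- **`‖Dⁱ(∂_v g)(x)‖ ≤ ‖v‖·‖D^{i+1}g(x)‖.** [cite: BenfattoGiulianiMastropietro2006, (2.36aa)] -/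
theorem norm_iteratedFDeriv_fbDir_le {g : FreqBand → ℂ} (i : ℕ) (hg : ContDiff ℝ ((i : ℕ∞) + 1) g) (v x : FreqBand) :
    ‖iteratedFDeriv ℝ i (fbDir g v) x‖ ≤ ‖v‖ * ‖iteratedFDeriv ℝ (i + 1) g x‖ := by
  have hf : ContDiffAt ℝ i (fderiv ℝ g) x := (hg.fderiv_right le_rfl).contDiffAt
  have h := norm_iteratedFDeriv_clm_apply_const (c := v) hf le_rfl
  rw [norm_iteratedFDeriv_fderiv] at h
  exact h

/-! ### §2 Composition with a band `u : E → ℝ` (general smooth `g`) -/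

section Comp

variable {E : Type*} [NormedAddCommGroup E] [NormedSpace ℝ E]

/-- **`‖Dⁿ(g(ω, u ·))(p)‖ ≤ n!·C·Dⁿ`** when `‖Dⁱg‖ ≤ C` at `(ω, u p)` for `i ≤ n` and `‖Dⁱu(p)‖ ≤ Dⁱ` for `1 ≤ i ≤ n`.
[cite: BenfattoGiulianiMastropietro2006, (2.36aa)] -/
theorem norm_iteratedFDeriv_comp_fbPt_le {g : FreqBand → ℂ} {n : ℕ} (hg : ContDiff ℝ n g) {u : E → ℝ} (hu : ContDiff ℝ n u)
    (ω : ℝ) (p : E) {C D : ℝ} (hC : ∀ i ≤ n, ‖iteratedFDeriv ℝ i g (fbPt ω (u p))‖ ≤ C)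
    (hD : ∀ i, 1 ≤ i → i ≤ n → ‖iteratedFDeriv ℝ i u p‖ ≤ D ^ i) :
    ‖iteratedFDeriv ℝ n (fun p => g (fbPt ω (u p))) p‖ ≤ n ! * C * D ^ n := by
  have h := norm_iteratedFDeriv_comp_le (g := g) (f := fun p => fbPt ω (u p)) (N := (n : ℕ∞)) hg (contDiff_fbPt_comp hu ω)
    le_rfl p hC (fun i hi1 hin => by
      rw [norm_iteratedFDeriv_fbPt_comp hi1 (hu.of_le (by exact_mod_cast hin)) ω p]; exact hD i hi1 hin)
  exact h

/-- **`‖Dᵇ(g(ω, u ·)·κ)(p)‖ ≤ Σ_{j ≤ b} C(b,j)·(j!·C′·Dʲ)·‖D^{b-j}κ(p)‖`** when `‖Dⁱg(ω, u p)‖ ≤ C′` for `i ≤ b` and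
`‖Dⁱu(p)‖ ≤ Dⁱ` for `1 ≤ i ≤ b` (`u, κ ∈ Cᵇ`). [cite: BenfattoGiulianiMastropietro2006, (2.36aa) and §3 (3.2)] -/
theorem norm_iteratedFDeriv_comp_fbPt_mul_le {g : FreqBand → ℂ} {b : ℕ} (hg : ContDiff ℝ b g) {u κ : E → ℝ}
    (hu : ContDiff ℝ b u) (hκ : ContDiff ℝ b κ) (ω : ℝ) (p : E) {C' D : ℝ}
    (hC' : ∀ i ≤ b, ‖iteratedFDeriv ℝ i g (fbPt ω (u p))‖ ≤ C')
    (hD : ∀ i, 1 ≤ i → i ≤ b → ‖iteratedFDeriv ℝ i u p‖ ≤ D ^ i) :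
    ‖iteratedFDeriv ℝ b (fun p => g (fbPt ω (u p)) * ((κ p : ℝ) : ℂ)) p‖ ≤
      ∑ j ∈ Finset.range (b + 1), (b.choose j : ℝ) * (j ! * C' * D ^ j) * ‖iteratedFDeriv ℝ (b - j) κ p‖ := by
  have hf : ContDiff ℝ b (fun p => g (fbPt ω (u p))) := hg.comp (contDiff_fbPt_comp hu ω)
  have hg' : ContDiff ℝ b (fun p => ((κ p : ℝ) : ℂ)) := Complex.ofRealCLM.contDiff.comp hκ
  have hL := norm_iteratedFDeriv_mul_le (N := (b : ℕ∞)) hf hg' p (n := b) le_rfl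
  refine hL.trans (Finset.sum_le_sum fun j hj => ?_)
  have hjb : j ≤ b := Nat.lt_succ_iff.1 (Finset.mem_range.1 hj)
  have h1 : ‖iteratedFDeriv ℝ j (fun p => g (fbPt ω (u p))) p‖ ≤ j ! * C' * D ^ j :=
    norm_iteratedFDeriv_comp_fbPt_le (hg.of_le (by exact_mod_cast hjb)) (hu.of_le (by exact_mod_cast hjb)) ω p
      (fun i hi => hC' i (hi.trans hjb)) (fun i hi1 hij => hD i hi1 (hij.trans hjb))
  have h2 : ‖iteratedFDeriv ℝ (b - j) (fun p => ((κ p : ℝ) : ℂ)) p‖ = ‖iteratedFDeriv ℝ (b - j) κ p‖ := by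
    have h : (fun p => ((κ p : ℝ) : ℂ)) = Complex.ofRealLI ∘ κ := rfl
    rw [h, Complex.ofRealLI.norm_iteratedFDeriv_comp_left ((hκ.of_le (by exact_mod_cast Nat.sub_le b j)).contDiffAt) le_rfl]
  rw [h2]
  have hC'0 : 0 ≤ C' := (norm_nonneg _).trans (hC' 0 (Nat.zero_le _))
  exact mul_le_mul_of_nonneg_right (mul_le_mul_of_nonneg_left h1 (Nat.cast_nonneg _)) (norm_nonneg _)

end Comp

/-! ### §3 Constants pass through iterated lattice differences -/

section Diff

variable {X : Type*} [AddCommGroup X]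

/-- `(Δ_v)ⁿ(F·c) = (Δ_v)ⁿF·c`. [cite: BenfattoGiulianiMastropietro2006, (2.36aa)] -/
theorem fwdDiff_iter_mul_const (v : X) (c : ℂ) :
    ∀ (n : ℕ) (F : X → ℂ), (fwdDiff v)^[n] (fun y => F y * c) = fun y => (fwdDiff v)^[n] F y * c
  | 0, F => rfl
  | n + 1, F => by
    have h1 : fwdDiff v (fun y => F y * c) = fun y => fwdDiff v F y * c := by
      funext y; simp only [fwdDiff, sub_mul]
    rw [Function.iterate_succ_apply, Function.iterate_succ_apply, h1, fwdDiff_iter_mul_const v c n]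

/-- `(Δ_u)ᵃ(Δ_v)ᵇ(F·c)(x) = (Δ_u)ᵃ(Δ_v)ᵇF(x)·c`. [cite: BenfattoGiulianiMastropietro2006, (2.36aa)] -/
theorem fwdDiff_iter₂_mul_const (u v : X) (c : ℂ) (a b : ℕ) (F : X → ℂ) (x : X) :
    (fwdDiff u)^[a] ((fwdDiff v)^[b] (fun y => F y * c)) x = (fwdDiff u)^[a] ((fwdDiff v)^[b] F) x * c := by
  rw [fwdDiff_iter_mul_const v c b F, fwdDiff_iter_mul_const u c a]

/-- `‖(Δ_u)ᵃ(Δ_v)ᵇ(F·c)(x)‖ = ‖(Δ_u)ᵃ(Δ_v)ᵇF(x)‖·‖c‖`. [cite: BenfattoGiulianiMastropietro2006, (2.36aa)] -/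
theorem norm_fwdDiff_iter₂_mul_const (u v : X) (c : ℂ) (a b : ℕ) (F : X → ℂ) (x : X) :
    ‖(fwdDiff u)^[a] ((fwdDiff v)^[b] (fun y => F y * c)) x‖ = ‖(fwdDiff u)^[a] ((fwdDiff v)^[b] F) x‖ * ‖c‖ := by
  rw [fwdDiff_iter₂_mul_const, norm_mul]

end Diff

/-! ### §4 The two interpolating families -/

/-- **Band interpolation**: `s ↦ g(ω, v + s·w)` has derivative `∂_{e₁}g(ω, v + s·w)·w`.
[cite: BenfattoGiulianiMastropietro2006, §3 (3.2)] -/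
theorem hasDerivAt_comp_fbPt_band {g : FreqBand → ℂ} (hg : Differentiable ℝ g) (ω v w s : ℝ) :
    HasDerivAt (fun s => g (fbPt ω (v + s * w))) (fbDir g fbE1 (fbPt ω (v + s * w)) * ((w : ℝ) : ℂ)) s := by
  have hpath : HasDerivAt (fun s => fbPt ω (v + s * w)) (w • fbE1) s := by
    have h : (fun s : ℝ => fbPt ω (v + s * w)) = fun s => fbPt ω v + (s * w) • fbE1 := by
      funext t; simp only [fbPt, add_smul]; abel
    rw [h]
    have h1 : HasDerivAt (fun s : ℝ => s * w) w s := by simpa using (hasDerivAt_id s).mul_const w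
    exact (h1.smul_const fbE1).const_add _
  have hG : HasFDerivAt g (fderiv ℝ g (fbPt ω (v + s * w))) (fbPt ω (v + s * w)) := (hg _).hasFDerivAt
  have h := hG.comp_hasDerivAt s hpath
  have heq : (fderiv ℝ g (fbPt ω (v + s * w))) (w • fbE1) = fbDir g fbE1 (fbPt ω (v + s * w)) * ((w : ℝ) : ℂ) := by
    rw [map_smul, fbDir, Complex.real_smul, mul_comm]
  rw [← heq]
  exact h

/-- **Frequency interpolation**: `t ↦ g(ω + t·δ, e)` has derivative `∂_{e₀}g(ω + t·δ, e)·δ`.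
[cite: BenfattoGiulianiMastropietro2006, §3 (3.2)] -/
theorem hasDerivAt_comp_fbPt_freq {g : FreqBand → ℂ} (hg : Differentiable ℝ g) (ω δ e t : ℝ) :
    HasDerivAt (fun t => g (fbPt (ω + t * δ) e)) (fbDir g fbE0 (fbPt (ω + t * δ) e) * ((δ : ℝ) : ℂ)) t := by
  have hpath : HasDerivAt (fun t => fbPt (ω + t * δ) e) (δ • fbE0) t := by
    have h : (fun t : ℝ => fbPt (ω + t * δ) e) = fun t => fbPt ω e + (t * δ) • fbE0 := by
      funext t; simp only [fbPt, add_smul]; abel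
    rw [h]
    have h1 : HasDerivAt (fun t : ℝ => t * δ) δ t := by simpa using (hasDerivAt_id t).mul_const δ
    exact (h1.smul_const fbE0).const_add _
  have hG : HasFDerivAt g (fderiv ℝ g (fbPt (ω + t * δ) e)) (fbPt (ω + t * δ) e) := (hg _).hasFDerivAt
  have h := hG.comp_hasDerivAt t hpath
  have heq : (fderiv ℝ g (fbPt (ω + t * δ) e)) (δ • fbE0) = fbDir g fbE0 (fbPt (ω + t * δ) e) * ((δ : ℝ) : ℂ) := by
    rw [map_smul, fbDir, Complex.real_smul, mul_comm]
  rw [← heq]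
  exact h

/-! ### §5 Mixed lattice differences of the two kinds of increments -/

section Increments

variable {X : Type*} [AddCommGroup X]

/-- **Band increment**: with `G_s(y) = g(ω, v(y) + s·w(y))` and `H_s(y) = ∂_{e₁}g(ω, v(y) + s·w(y))·w(y)`,
`‖(Δ_{u₁})ᵃ(Δ_{u₂})ᵇ G_1(x) − (Δ_{u₁})ᵃ(Δ_{u₂})ᵇ G_0(x)‖ ≤ sup_{s ∈ [0,1)} ‖(Δ_{u₁})ᵃ(Δ_{u₂})ᵇ H_s(x)‖`.
[cite: BenfattoGiulianiMastropietro2006, §3 (3.2)–(3.8)] -/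
theorem norm_fwdDiff_iter₂_comp_fbPt_band_increment_le {g : FreqBand → ℂ} (hg : Differentiable ℝ g) (ω : ℝ) (v w : X → ℝ)
    (u₁ u₂ : X) (a b : ℕ) (x : X) {C : ℝ}
    (hC : ∀ s ∈ Ico (0 : ℝ) 1,
      ‖(fwdDiff u₁)^[a] ((fwdDiff u₂)^[b] (fun y => fbDir g fbE1 (fbPt ω (v y + s * w y)) * ((w y : ℝ) : ℂ))) x‖ ≤ C) :
    ‖(fwdDiff u₁)^[a] ((fwdDiff u₂)^[b] (fun y => g (fbPt ω (v y + w y)))) x -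
        (fwdDiff u₁)^[a] ((fwdDiff u₂)^[b] (fun y => g (fbPt ω (v y)))) x‖ ≤ C := by
  have h := norm_fwdDiff_iter₂_sub_le_of_family (F := fun s y => g (fbPt ω (v y + s * w y)))
    (F' := fun s y => fbDir g fbE1 (fbPt ω (v y + s * w y)) * ((w y : ℝ) : ℂ))
    (fun s y => hasDerivAt_comp_fbPt_band hg ω (v y) (w y) s) u₁ u₂ a b x hC
  simpa only [one_mul, zero_mul, add_zero] using h

/-- **Frequency increment**: with `G_t(y) = g(ω + t(ω′−ω), e(y))` and `H_t(y) = ∂_{e₀}g(ω + t(ω′−ω), e(y))·(ω′−ω)`,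
`‖(Δ_{u₁})ᵃ(Δ_{u₂})ᵇ(g(ω′, e ·))(x) − (Δ_{u₁})ᵃ(Δ_{u₂})ᵇ(g(ω, e ·))(x)‖ ≤ sup_{t ∈ [0,1)} ‖(Δ_{u₁})ᵃ(Δ_{u₂})ᵇ H_t(x)‖`.
[cite: BenfattoGiulianiMastropietro2006, §3 (3.2)–(3.8)] -/
theorem norm_fwdDiff_iter₂_comp_fbPt_freq_increment_le {g : FreqBand → ℂ} (hg : Differentiable ℝ g) (ω ω' : ℝ) (e : X → ℝ)
    (u₁ u₂ : X) (a b : ℕ) (x : X) {C : ℝ}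
    (hC : ∀ t ∈ Ico (0 : ℝ) 1,
      ‖(fwdDiff u₁)^[a] ((fwdDiff u₂)^[b] (fun y => fbDir g fbE0 (fbPt (ω + t * (ω' - ω)) (e y)) * (((ω' - ω : ℝ)) : ℂ))) x‖ ≤ C) :
    ‖(fwdDiff u₁)^[a] ((fwdDiff u₂)^[b] (fun y => g (fbPt ω' (e y)))) x -
        (fwdDiff u₁)^[a] ((fwdDiff u₂)^[b] (fun y => g (fbPt ω (e y)))) x‖ ≤ C := by
  have h := norm_fwdDiff_iter₂_sub_le_of_family (F := fun t y => g (fbPt (ω + t * (ω' - ω)) (e y)))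
    (F' := fun t y => fbDir g fbE0 (fbPt (ω + t * (ω' - ω)) (e y)) * (((ω' - ω : ℝ)) : ℂ))
    (fun t y => hasDerivAt_comp_fbPt_freq hg ω (ω' - ω) (e y) t) u₁ u₂ a b x hC
  simpa only [one_mul, zero_mul, add_zero, add_sub_cancel] using h

end Increments

/-! ### §6 The directional derivatives of `Ψ`: bounds along a fibre and along a frequency segment -/

/-- **`‖Dⁱ(∂_vΨ)(x)‖ ≤ ‖v‖·c·B·(i+2)!·(2/max(|ω|,Λ/2))^{i+2}`** (`i + 1 ≤ N` cutoff derivatives bounded by `B ≥ 1`).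
[cite: Salmhofer1999, §4.2.5 (4.70)] -/
theorem norm_iteratedFDeriv_fbDir_uvSymbol₂_le {c Λ : ℝ} (hc : 0 ≤ c) (hΛ : 0 < Λ) {N : ℕ} {B : ℝ} (hB1 : 1 ≤ B)
    (hB : ∀ i ≤ N, ∀ t, ‖iteratedDeriv i salmhoferCutoff t‖ ≤ B) {i : ℕ} (hi : i + 1 ≤ N) (v x : FreqBand) :
    ‖iteratedFDeriv ℝ i (fbDir (uvSymbol₂ c Λ) v) x‖ ≤ ‖v‖ * (c * B * (i + 2) ! * (2 / max |x 0| (Λ / 2)) ^ (i + 2)) := by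
  have h1 := norm_iteratedFDeriv_fbDir_le i (contDiff_uvSymbol₂ c hΛ) v x
  have h2 := norm_iteratedFDeriv_uvSymbol₂_le hc hΛ hB1 hB hi x
  exact h1.trans (mul_le_mul_of_nonneg_left h2 (norm_nonneg _))

/-- **`‖Dⁱ(∂_{v′}∂_vΨ)(x)‖ ≤ ‖v′‖·‖v‖·c·B·(i+3)!·(2/max(|ω|,Λ/2))^{i+3}`** (`i + 2 ≤ N`). [cite: Salmhofer1999, §4.2.5 (4.70)] -/
theorem norm_iteratedFDeriv_fbDir_fbDir_uvSymbol₂_le {c Λ : ℝ} (hc : 0 ≤ c) (hΛ : 0 < Λ) {N : ℕ} {B : ℝ} (hB1 : 1 ≤ B)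
    (hB : ∀ i ≤ N, ∀ t, ‖iteratedDeriv i salmhoferCutoff t‖ ≤ B) {i : ℕ} (hi : i + 2 ≤ N) (v v' x : FreqBand) :
    ‖iteratedFDeriv ℝ i (fbDir (fbDir (uvSymbol₂ c Λ) v) v') x‖ ≤
      ‖v'‖ * (‖v‖ * (c * B * (i + 3) ! * (2 / max |x 0| (Λ / 2)) ^ (i + 3))) := by
  have hg : ContDiff ℝ ((i : ℕ∞) + 1 + 1) (uvSymbol₂ c Λ) := contDiff_uvSymbol₂ c hΛ
  have h1 := norm_iteratedFDeriv_fbDir_le i (contDiff_fbDir hg v) v' x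
  have h2 := norm_iteratedFDeriv_fbDir_le (i + 1) (contDiff_uvSymbol₂ c hΛ) v x
  have h3 := norm_iteratedFDeriv_uvSymbol₂_le hc hΛ hB1 hB (n := i + 1 + 1) (by omega) x
  have h23 : ‖iteratedFDeriv ℝ (i + 1) (fbDir (uvSymbol₂ c Λ) v) x‖ ≤
      ‖v‖ * (c * B * (i + 3) ! * (2 / max |x 0| (Λ / 2)) ^ (i + 3)) := by
    refine h2.trans (mul_le_mul_of_nonneg_left ?_ (norm_nonneg _))
    simpa only [show i + 1 + 1 + 1 = i + 3 by ring, show i + 1 + 1 = i + 2 by ring, Nat.cast_add, Nat.cast_ofNat,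
      show (i : ℝ) + 2 + 1 = i + 3 by ring] using h3
  exact h1.trans (mul_le_mul_of_nonneg_left h23 (norm_nonneg _))

/-- On the segment from `(ω,e)` to `(ω′,e)` the frequency is at least `|ω| − |ω′−ω|` in absolute value.
[cite: BenfattoGiulianiMastropietro2006, §2.1 Lemma 2.2] -/
theorem abs_fbPt_interp_zero_ge (ω ω' e : ℝ) {t : ℝ} (ht : t ∈ Icc (0 : ℝ) 1) :
    |ω| - |ω' - ω| ≤ |fbPt (ω + t * (ω' - ω)) e 0| := by
  rw [fbPt_apply_zero]
  have h1 : |ω| - |t * (ω' - ω)| ≤ |ω + t * (ω' - ω)| := by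
    have := abs_sub_abs_le_abs_sub ω (-(t * (ω' - ω)))
    rw [abs_neg, sub_neg_eq_add] at this
    exact this
  have h2 : |t * (ω' - ω)| ≤ |ω' - ω| := by
    rw [abs_mul, abs_of_nonneg ht.1]
    exact mul_le_of_le_one_left (abs_nonneg _) ht.2
  linarith

/-- **The envelope along a frequency segment is at least the shifted envelope**:
`(2/max(|ω + t(ω′−ω)|, Λ/2))ᵏ ≤ (2/max(|ω| − |ω′−ω|, Λ/2))ᵏ` for `t ∈ [0,1]`. [cite: BenfattoGiulianiMastropietro2006, §2.1 Lemma 2.2] -/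
theorem two_div_max_fbPt_interp_pow_le {Λ : ℝ} (hΛ : 0 < Λ) (ω ω' e : ℝ) {t : ℝ} (ht : t ∈ Icc (0 : ℝ) 1) (k : ℕ) :
    (2 / max |fbPt (ω + t * (ω' - ω)) e 0| (Λ / 2)) ^ k ≤ (2 / max (|ω| - |ω' - ω|) (Λ / 2)) ^ k := by
  have hm : 0 < max (|ω| - |ω' - ω|) (Λ / 2) := lt_max_of_lt_right (by positivity)
  have hle : max (|ω| - |ω' - ω|) (Λ / 2) ≤ max |fbPt (ω + t * (ω' - ω)) e 0| (Λ / 2) :=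
    max_le_max (abs_fbPt_interp_zero_ge ω ω' e ht) le_rfl
  exact pow_le_pow_left₀ (by positivity) (div_le_div_of_nonneg_left (by norm_num) hm hle) k

/-- `(2/max(s,Λ/2))^{i+k} ≤ (4/Λ)ⁱ·(2/max(s,Λ/2))ᵏ` (the envelope never exceeds `4/Λ`). [cite: Salmhofer1999, §4.2.5 (4.70)] -/
theorem two_div_max_pow_add_le {Λ : ℝ} (hΛ : 0 < Λ) (s : ℝ) (i k : ℕ) :
    (2 / max s (Λ / 2)) ^ (i + k) ≤ (4 / Λ) ^ i * (2 / max s (Λ / 2)) ^ k := by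
  have hm : 0 < max s (Λ / 2) := lt_max_of_lt_right (by positivity)
  have h1 : 2 / max s (Λ / 2) ≤ 4 / Λ := by
    rw [div_le_div_iff₀ hm hΛ]
    nlinarith [le_max_right s (Λ / 2)]
  rw [pow_add]
  exact mul_le_mul_of_nonneg_right (pow_le_pow_left₀ (by positivity) h1 i) (by positivity)

end Literature.MathematicalPhysics.QuantumLattice

end
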